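import Summits.Ventures.QEC.Census.CertCoverBatch
import Summits.Ventures.QEC.Census.BB.S8_126_w6_k12_01061B01.CoreDefs
import HarnessLib

set_option Elab.async false
set_option maxRecDepth 200000

/-!
# `[[252,12,16]]` one-level cover certificate of `S8_126_w6_k12_01061B01` — LEVEL-1→0 coset problems 10…15 (deep problems [0] excluded: `ProbDeep*.lean`) as COMPACT data
(`ProbData`: U, f, σ, y₀, allow; qec-type-10 `CertCoverBatch.mkCoset` rebuilds each `CosetProb` in the kernel) + their verdict
`probsOK cov covR hx hx1 D1 lxd 14` (one `decide +kernel`; 6 problems, depths f=0:2 f=1:3 f=2:1 f=3:0, est. 71.0 s).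
qec-search-1 g5 (pattern of search-9 g5 `Probs*`); data from JSON `level10.problems` (sha256 75f002ace624d82a…). Data + decided check; KERNEL.
-/

namespace Summit.Ventures.QEC.Census.S8_126_w6_k12_01061B01

open Matrix Summit.Ventures.QEC.Census Literature.InformationTheory.QuantumCodes

/-- Problems 10…15 (6): `⟨U, f, σ, y₀, allow⟩`. -/
def probs01 : List ProbData := [
    ⟨24230472800038703419884608, 1, 1154188554589442304, 4849879601279162489766976, [0]⟩,
    ⟨41143628358647443986056352, 0, 1154399317227737728, 9223442405600003200, [0]⟩,
    ⟨48394822093023415467246720, 2, 1154328879763034624, 9671415780289070253474944, [0, 9444732965739290427392]⟩,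
    ⟨48508200393787552310498432, 0, 5770519598403179008, 9822536119428016839328896, [0]⟩,
    ⟨96780189076787275304535296, 1, 1154611179377660928, 77380706412236993279820800, [0]⟩,
    ⟨164413921845290758988367488, 1, 1153204079384599040, 1153203254465659392, [0]⟩]

set_option maxHeartbeats 400000000 in
/-- Every problem of this chunk passes (`mkCoset` elimination + `cosetOKD` + fast `σ` + depth + `BU`-evenness + label checks). -/
theorem probs01_ok : probsOK S8_126_w6_k12_01061B01.cov covR hx hx1 D1 lxd 14 probs01 = true := by
  decide +kernel

/-- Pointwise form. -/
theorem probs01_all : ∀ x ∈ S8_126_w6_k12_01061B01.probs01, probOK cov covR hx hx1 D1 lxd 14 x = true := by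
  have h := probs01_ok
  rwa [probsOK, List.all_eq_true] at h

end Summit.Ventures.QEC.Census.S8_126_w6_k12_01061B01
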